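import Summits.AtomisticToContinuum.BoseEinsteinCondensation.Theses.BECConjugateDomination
import Literature.MathematicalPhysics.QuantumManyBody.InsertionStateIdentities
import Literature.MathematicalPhysics.QuantumManyBody.PeriodicBoseGasEq317
import Literature.MathematicalPhysics.QuantumManyBody.BoseGasFreeDirichletBEC

/-!
# Route `BECConjugateDomination`, support item `ShortDistanceCoherence`
(stmt-AtomisticToContinuum-11789)

**Kinetic short-distance coherence.** For every periodic `C¹` trial state `Ψ` of `N = n + 1`
bosons on the torus of side `L > 0` with finite kinetic energy `T = ∫_{cell^N} |∇Ψ|²` and every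
`r ∈ ℝ³`, the translation-averaged one-body coherence satisfies

`g(r) := ∫_cell dx ∫_{cell^n} dY |Ψ(x + r, Y)| |Ψ(x, Y)| ≥ 1 − |r|² T / (2N)`.

Proof (elementary, real space): pointwise `|a||b| ≥ (|a|² + |b|² − |a − b|²)/2`; on the
`N`-particle cell, with `e = e₀ ⊗ r` the shift of particle `0`, `∫|Ψ|² = 1` (normalisation),
`∫|Ψ(· + e)|² = 1` (periodicity: the cell is a fundamental domain, `lintegral_cellN_comp_add`),
and `∫|Ψ(· + e) − Ψ|² ≤ |r|² ∫|∇₀Ψ|²` by the fundamental theorem of calculus along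
`t ↦ X + t e`, Cauchy–Schwarz in `t ∈ [0,1]` and in the three axes, Tonelli, and shift-invariance
of the cell integral of the periodic density `|∇₀Ψ|²`; Bose symmetry gives `N ∫|∇₀Ψ|² = T`;
finally Fubini `cell^N ≅ cell × cell^n` (`setIntegral_cellN_succ_left_of_continuous`) turns the
cell integral into the iterated Bochner integral of the statement.

References: folklore (the kinetic bound on the translation-averaged density matrix behind the
Pitaevskii–Stringari / LSSY Ch. 5 heuristics); no named fact is used.
-/

noncomputable section

namespace Summit.AtomisticToContinuum.BoseEinsteinCondensation.Theorems

open MeasureTheory Set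
open scoped ENNReal NNReal
open Literature.MathematicalPhysics.QuantumManyBody.BoseGas

variable {n : ℕ} {L : ℝ}

/-! ### Elementary inequalities -/

/-- `|a|·|b| ≥ (|a|² + |b|² − |a − b|²)/2` (reverse triangle inequality, squared). [folklore] -/
theorem sdc_half_le_norm_mul_norm (a b : ℂ) :
    (‖a‖ ^ 2 + ‖b‖ ^ 2 - ‖a - b‖ ^ 2) / 2 ≤ ‖a‖ * ‖b‖ := by
  have h1 : |‖a‖ - ‖b‖| ≤ ‖a - b‖ := abs_norm_sub_norm_le a b
  have h2 : (‖a‖ - ‖b‖) ^ 2 ≤ ‖a - b‖ ^ 2 := by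
    calc (‖a‖ - ‖b‖) ^ 2 = |‖a‖ - ‖b‖| ^ 2 := (sq_abs _).symm
      _ ≤ ‖a - b‖ ^ 2 := pow_le_pow_left₀ (abs_nonneg _) h1 2
  nlinarith [h2]

/-- Cauchy–Schwarz on the unit interval: `(∫₀¹ f)² ≤ ∫₀¹ f²` for continuous `f`
(non-negativity of `∫₀¹ (s + f)²` in `s` and the discriminant). [folklore] -/
theorem sdc_sq_integral_unit_le {f : ℝ → ℝ} (hf : Continuous f) :
    (∫ t in (0:ℝ)..1, f t) ^ 2 ≤ ∫ t in (0:ℝ)..1, f t ^ 2 := by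
  -- adapted from Literature/Analysis/Complex/CarlemanDichotomy.lean (`sq_integral_le_mul_integral_sq`)
  have hi : IntervalIntegrable f volume 0 1 := hf.intervalIntegrable _ _
  have hi2 : IntervalIntegrable (fun x => f x ^ 2) volume 0 1 := (hf.pow 2).intervalIntegrable _ _
  have hq : ∀ s : ℝ, 0 ≤ 1 * (s * s) + (2 * ∫ x in (0:ℝ)..1, f x) * s + ∫ x in (0:ℝ)..1, f x ^ 2 := by
    intro s
    have h1 : ∀ x, (s + f x) ^ 2 = (s * s + 2 * s * f x) + f x ^ 2 := fun x => by ring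
    have h2 : ∫ x in (0:ℝ)..1, (s + f x) ^ 2 =
        1 * (s * s) + (2 * ∫ x in (0:ℝ)..1, f x) * s + ∫ x in (0:ℝ)..1, f x ^ 2 := by
      simp_rw [h1]
      rw [intervalIntegral.integral_add (intervalIntegrable_const.add (hi.const_mul _)) hi2,
        intervalIntegral.integral_add intervalIntegrable_const (hi.const_mul _),
        intervalIntegral.integral_const, intervalIntegral.integral_const_mul]
      simp only [sub_zero, one_smul]
      ring
    rw [← h2]
    exact intervalIntegral.integral_nonneg zero_le_one fun x _ => sq_nonneg _
  have hd := discrim_le_zero hq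
  rw [discrim] at hd
  nlinarith [hd]

/-- Finite Cauchy–Schwarz for a real combination of vectors:
`‖∑ a_k z_k‖² ≤ (∑ a_k²)(∑ ‖z_k‖²)`. [folklore] -/
theorem sdc_norm_sum_smul_sq_le {ι : Type*} (s : Finset ι) (a : ι → ℝ) (z : ι → ℂ) :
    ‖∑ c ∈ s, a c • z c‖ ^ 2 ≤ (∑ c ∈ s, a c ^ 2) * ∑ c ∈ s, ‖z c‖ ^ 2 := by
  have h1 : ‖∑ c ∈ s, a c • z c‖ ≤ ∑ c ∈ s, |a c| * ‖z c‖ :=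
    (norm_sum_le _ _).trans (le_of_eq (Finset.sum_congr rfl fun c _ => by
      rw [norm_smul, Real.norm_eq_abs]))
  calc ‖∑ c ∈ s, a c • z c‖ ^ 2 ≤ (∑ c ∈ s, |a c| * ‖z c‖) ^ 2 :=
        pow_le_pow_left₀ (norm_nonneg _) h1 2
    _ ≤ (∑ c ∈ s, |a c| ^ 2) * ∑ c ∈ s, ‖z c‖ ^ 2 := Finset.sum_mul_sq_le_sq_mul_sq s _ _
    _ = (∑ c ∈ s, a c ^ 2) * ∑ c ∈ s, ‖z c‖ ^ 2 := by simp only [sq_abs]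

/-! ### The directional derivative along `e₀ ⊗ r` -/

/-- `e₀ ⊗ r = ∑ₖ rₖ (e₀ ⊗ eₖ)` in `(ℝ³)^{n+1}`. [folklore] -/
theorem sdc_single_zero_eq_sum (r : Space) :
    (Pi.single 0 r : Config (n + 1)) =
      ∑ k : Fin 3, r k • (Pi.single 0 (EuclideanSpace.single k (1 : ℝ)) : Config (n + 1)) := by
  have hr : r = ∑ k : Fin 3, r k • EuclideanSpace.single k (1 : ℝ) := by
    conv_lhs => rw [← (EuclideanSpace.basisFun (Fin 3) ℝ).sum_repr r]
    refine Finset.sum_congr rfl fun k _ => ?_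
    rw [EuclideanSpace.basisFun_apply, EuclideanSpace.basisFun_repr]
  funext j
  rw [Finset.sum_apply]
  by_cases hj : j = 0
  · subst hj
    simp only [Pi.single_eq_same, Pi.smul_apply]
    exact hr
  · simp only [Pi.single_eq_of_ne hj, Pi.smul_apply, smul_zero, Finset.sum_const_zero]

/-- Cauchy–Schwarz over the three axes: `‖DΨ(Z)(e₀ ⊗ r)‖² ≤ ‖r‖² |∇₀Ψ(Z)|²`. [folklore] -/
theorem sdc_norm_fderiv_single_sq_le (ψ : Config (n + 1) → ℂ) (Z : Config (n + 1)) (r : Space) :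
    ‖fderiv ℝ ψ Z (Pi.single 0 r)‖ ^ 2 ≤
      ‖r‖ ^ 2 * ∑ k : Fin 3,
        ‖fderiv ℝ ψ Z (Pi.single 0 (EuclideanSpace.single k (1 : ℝ)))‖ ^ 2 := by
  rw [sdc_single_zero_eq_sum r, map_sum]
  simp only [map_smul]
  rw [EuclideanSpace.real_norm_sq_eq]
  exact sdc_norm_sum_smul_sq_le _ _ _

/-- **FTC + Cauchy–Schwarz along the segment**:
`‖Ψ(X + e₀⊗r) − Ψ(X)‖² ≤ ‖r‖² ∫₀¹ |∇₀Ψ|²(X + t·e₀⊗r) dt` for `C¹` `Ψ`. [folklore] -/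
theorem sdc_norm_sub_sq_le {ψ : Config (n + 1) → ℂ} (hψ : ContDiff ℝ 1 ψ) (X : Config (n + 1))
    (r : Space) :
    ‖ψ (X + Pi.single 0 r) - ψ X‖ ^ 2 ≤
      ‖r‖ ^ 2 * ∫ t in (0:ℝ)..1, ∑ k : Fin 3,
        ‖fderiv ℝ ψ (X + t • (Pi.single 0 r : Config (n + 1)))
          (Pi.single 0 (EuclideanSpace.single k (1 : ℝ)))‖ ^ 2 := by
  set e : Config (n + 1) := Pi.single 0 r with he
  have hd : Differentiable ℝ ψ := hψ.differentiable one_ne_zero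
  have hcf : Continuous (fderiv ℝ ψ) := hψ.continuous_fderiv one_ne_zero
  have hpath : Continuous fun t : ℝ => X + t • e :=
    continuous_const.add (continuous_id.smul continuous_const)
  -- the path and its derivative
  have hγ : ∀ t : ℝ, HasDerivAt (fun s : ℝ => X + s • e) e t := fun t => by
    have h := ((hasDerivAt_id t).smul_const e).const_add X
    simpa using h
  set φ : ℝ → ℂ := fun t => fderiv ℝ ψ (X + t • e) e with hφ
  have hderiv : ∀ t : ℝ, HasDerivAt (fun s : ℝ => ψ (X + s • e)) (φ t) t := fun t =>
    (hd (X + t • e)).hasFDerivAt.comp_hasDerivAt t (hγ t)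
  have hφc : Continuous φ := (hcf.comp hpath).clm_apply continuous_const
  have hftc : ∫ t in (0:ℝ)..1, φ t = ψ (X + e) - ψ X := by
    have h := intervalIntegral.integral_eq_sub_of_hasDerivAt (fun t _ => hderiv t)
      (hφc.intervalIntegrable 0 1)
    simpa using h
  -- the integrand on the right
  set g : ℝ → ℝ := fun t => ∑ k : Fin 3,
    ‖fderiv ℝ ψ (X + t • e) (Pi.single 0 (EuclideanSpace.single k (1 : ℝ)))‖ ^ 2 with hg
  have hgc : Continuous g :=
    continuous_finsetSum _ fun k _ => ((hcf.comp hpath).clm_apply continuous_const).norm.pow 2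
  have hpt : ∀ t, ‖φ t‖ ^ 2 ≤ ‖r‖ ^ 2 * g t := fun t =>
    sdc_norm_fderiv_single_sq_le ψ (X + t • e) r
  calc ‖ψ (X + e) - ψ X‖ ^ 2 = ‖∫ t in (0:ℝ)..1, φ t‖ ^ 2 := by rw [hftc]
    _ ≤ (∫ t in (0:ℝ)..1, ‖φ t‖) ^ 2 :=
        pow_le_pow_left₀ (norm_nonneg _)
          (intervalIntegral.norm_integral_le_integral_norm zero_le_one) 2
    _ ≤ ∫ t in (0:ℝ)..1, ‖φ t‖ ^ 2 := sdc_sq_integral_unit_le hφc.norm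
    _ ≤ ∫ t in (0:ℝ)..1, ‖r‖ ^ 2 * g t :=
        intervalIntegral.integral_mono_on zero_le_one ((hφc.norm.pow 2).intervalIntegrable _ _)
          ((continuous_const.mul hgc).intervalIntegrable _ _) fun t _ => hpt t
    _ = ‖r‖ ^ 2 * ∫ t in (0:ℝ)..1, g t := intervalIntegral.integral_const_mul _ _

/-- The same bound in `ℝ≥0∞`, with the partial gradient `|∇₀Ψ|² = partialGradSq 0 Ψ`:
`‖Ψ(X + e₀⊗r) − Ψ(X)‖₊² ≤ ‖r‖² ∫_{(0,1]} |∇₀Ψ|²(X + t·e₀⊗r) dt`. [folklore] -/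
theorem sdc_nnnorm_sub_sq_le {ψ : Config (n + 1) → ℂ} (hψ : ContDiff ℝ 1 ψ) (X : Config (n + 1))
    (r : Space) :
    ((‖ψ (X + Pi.single 0 r) - ψ X‖₊ : ℝ≥0∞) ^ 2) ≤
      ENNReal.ofReal (‖r‖ ^ 2) *
        ∫⁻ t in Ioc (0:ℝ) 1, partialGradSq 0 ψ (X + t • (Pi.single 0 r : Config (n + 1))) := by
  set e : Config (n + 1) := Pi.single 0 r with he
  have hcf : Continuous (fderiv ℝ ψ) := hψ.continuous_fderiv one_ne_zero
  have hpath : Continuous fun t : ℝ => X + t • e :=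
    continuous_const.add (continuous_id.smul continuous_const)
  set g : ℝ → ℝ := fun t => ∑ k : Fin 3,
    ‖fderiv ℝ ψ (X + t • e) (Pi.single 0 (EuclideanSpace.single k (1 : ℝ)))‖ ^ 2 with hg
  have hgc : Continuous g :=
    continuous_finsetSum _ fun k _ => ((hcf.comp hpath).clm_apply continuous_const).norm.pow 2
  have hg0 : ∀ t, 0 ≤ g t := fun t => Finset.sum_nonneg fun k _ => sq_nonneg _
  have hgE : ∀ t, ENNReal.ofReal (g t) = partialGradSq 0 ψ (X + t • e) := by
    intro t
    simp only [hg, partialGradSq]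
    rw [ENNReal.ofReal_sum_of_nonneg (fun k _ => sq_nonneg _)]
    refine Finset.sum_congr rfl fun k _ => ?_
    rw [ENNReal.ofReal_pow (norm_nonneg _), ofReal_norm, enorm_eq_nnnorm]
  have h := sdc_norm_sub_sq_le hψ X r
  calc ((‖ψ (X + e) - ψ X‖₊ : ℝ≥0∞) ^ 2) = ENNReal.ofReal (‖ψ (X + e) - ψ X‖ ^ 2) := by
        rw [ENNReal.ofReal_pow (norm_nonneg _), ofReal_norm, enorm_eq_nnnorm]
    _ ≤ ENNReal.ofReal (‖r‖ ^ 2 * ∫ t in (0:ℝ)..1, g t) := ENNReal.ofReal_le_ofReal h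
    _ = ENNReal.ofReal (‖r‖ ^ 2) * ENNReal.ofReal (∫ t in Ioc (0:ℝ) 1, g t) := by
        rw [ENNReal.ofReal_mul (sq_nonneg _), intervalIntegral.integral_of_le zero_le_one]
    _ = ENNReal.ofReal (‖r‖ ^ 2) * ∫⁻ t in Ioc (0:ℝ) 1, partialGradSq 0 ψ (X + t • e) := by
        rw [ofReal_integral_eq_lintegral_ofReal hgc.integrableOn_Ioc (ae_of_all _ hg0)]
        simp only [hgE]

/-! ### Integrating over the `N`-particle cell -/

/-- The partial gradient `|∇₀Ψ|²` of a periodic state is periodic in every particle and axis.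
[folklore] -/
theorem sdc_partialGradSq_add_single (Ψ : PeriodicTrialState (n + 1) L) (X : Config (n + 1))
    (i : Fin (n + 1)) (k : Fin 3) :
    partialGradSq 0 Ψ.ψ (X + Pi.single i (EuclideanSpace.single k L)) = partialGradSq 0 Ψ.ψ X := by
  have h : (fun Y => Ψ.ψ (Y + Pi.single i (EuclideanSpace.single k L))) = Ψ.ψ :=
    funext fun Y => Ψ.periodic Y i k
  conv_rhs => rw [← h]
  simp only [partialGradSq, fderiv_comp_add_right]

/-- **`∫_{cell^N} ‖Ψ(X + e₀⊗r) − Ψ(X)‖² ≤ ‖r‖² ∫_{cell^N} |∇₀Ψ|²`** for a periodic `C¹` state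
(pointwise FTC bound, Tonelli, and shift-invariance of the cell integral of the periodic
`|∇₀Ψ|²`). [folklore] -/
theorem sdc_lintegral_nnnorm_sub_sq_le (hL : 0 < L) (Ψ : PeriodicTrialState (n + 1) L)
    (r : Space) :
    ∫⁻ X in cellN (n + 1) L, ((‖Ψ.ψ (X + Pi.single 0 r) - Ψ.ψ X‖₊ : ℝ≥0∞) ^ 2) ≤
      ENNReal.ofReal (‖r‖ ^ 2) * ∫⁻ X in cellN (n + 1) L, partialGradSq 0 Ψ.ψ X := by
  set e : Config (n + 1) := Pi.single 0 r with he
  have hG : Measurable (partialGradSq 0 Ψ.ψ) := measurable_partialGradSq 0 Ψ.ψ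
  -- Tonelli for `(X, t) ↦ |∇₀Ψ|²(X + t e)`
  have hF : AEMeasurable (Function.uncurry fun (X : Config (n + 1)) (t : ℝ) =>
      partialGradSq 0 Ψ.ψ (X + t • e))
      ((volume.restrict (cellN (n + 1) L)).prod (volume.restrict (Ioc (0:ℝ) 1))) := by
    have hc : Continuous fun p : Config (n + 1) × ℝ => p.1 + p.2 • e :=
      continuous_fst.add (continuous_snd.smul continuous_const)
    exact (hG.comp hc.measurable).aemeasurable
  calc ∫⁻ X in cellN (n + 1) L, ((‖Ψ.ψ (X + e) - Ψ.ψ X‖₊ : ℝ≥0∞) ^ 2)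
      ≤ ∫⁻ X in cellN (n + 1) L, ENNReal.ofReal (‖r‖ ^ 2) *
          ∫⁻ t in Ioc (0:ℝ) 1, partialGradSq 0 Ψ.ψ (X + t • e) :=
        lintegral_mono fun X => sdc_nnnorm_sub_sq_le Ψ.contDiff X r
    _ = ENNReal.ofReal (‖r‖ ^ 2) *
          ∫⁻ X in cellN (n + 1) L, ∫⁻ t in Ioc (0:ℝ) 1, partialGradSq 0 Ψ.ψ (X + t • e) := by
        rw [lintegral_const_mul' _ _ ENNReal.ofReal_ne_top]
    _ = ENNReal.ofReal (‖r‖ ^ 2) *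
          ∫⁻ t in Ioc (0:ℝ) 1, ∫⁻ X in cellN (n + 1) L, partialGradSq 0 Ψ.ψ (X + t • e) := by
        rw [lintegral_lintegral_swap hF]
    _ = ENNReal.ofReal (‖r‖ ^ 2) *
          ∫⁻ t in Ioc (0:ℝ) 1, ∫⁻ X in cellN (n + 1) L, partialGradSq 0 Ψ.ψ X := by
        congr 1
        refine lintegral_congr fun t => ?_
        exact lintegral_cellN_comp_add hL (G := partialGradSq 0 Ψ.ψ)
          (sdc_partialGradSq_add_single Ψ) (t • e)
    _ = ENNReal.ofReal (‖r‖ ^ 2) * ∫⁻ X in cellN (n + 1) L, partialGradSq 0 Ψ.ψ X := by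
        rw [setLIntegral_const, Real.volume_Ioc, sub_zero, ENNReal.ofReal_one, mul_one]

/-- **Bose symmetry**: `∫_{cell^N} |∇Ψ|² = N ∫_{cell^N} |∇₀Ψ|²` for a periodic trial state of
`N = n + 1` bosons. [folklore] -/
theorem sdc_lintegral_kineticDensity_eq_mul (Ψ : PeriodicTrialState (n + 1) L) :
    ∫⁻ X in cellN (n + 1) L, kineticDensity Ψ.ψ X =
      ((n : ℝ≥0∞) + 1) * ∫⁻ X in cellN (n + 1) L, partialGradSq 0 Ψ.ψ X := by
  have hd : Differentiable ℝ Ψ.ψ := Ψ.contDiff.differentiable one_ne_zero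
  simp only [kineticDensity_eq_sum_partialGradSq]
  rw [lintegral_finsetSum _ fun i _ => measurable_partialGradSq i Ψ.ψ]
  have hi : ∀ i : Fin (n + 1), ∫⁻ X in cellN (n + 1) L, partialGradSq i Ψ.ψ X =
      ∫⁻ X in cellN (n + 1) L, partialGradSq 0 Ψ.ψ X := fun i =>
    calc ∫⁻ X in cellN (n + 1) L, partialGradSq i Ψ.ψ X
        = ∫⁻ X in cellN (n + 1) L, partialGradSq 0 Ψ.ψ (X ∘ Equiv.swap 0 i) :=
          lintegral_congr fun X => partialGradSq_eq_zero_comp_swap hd Ψ.symm i X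
      _ = ∫⁻ X in cellN (n + 1) L, partialGradSq 0 Ψ.ψ X :=
          lintegral_cellN_comp_perm (Equiv.swap 0 i) (partialGradSq 0 Ψ.ψ)
  simp only [hi, Finset.sum_const, Finset.card_univ, Fintype.card_fin, nsmul_eq_mul, Nat.cast_add,
    Nat.cast_one]

/-- `ofReal (‖a‖²) = ‖a‖₊²` in `ℝ≥0∞`. [folklore] -/
theorem sdc_ofReal_norm_sq (a : ℂ) : ENNReal.ofReal (‖a‖ ^ 2) = ((‖a‖₊ : ℝ≥0∞) ^ 2) := by
  rw [ENNReal.ofReal_pow (norm_nonneg _), ofReal_norm, enorm_eq_nnnorm]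

/-- `∫_{cell^N} |Ψ|² = 1` as a Bochner integral (normalisation). [folklore] -/
theorem sdc_integral_norm_sq (Ψ : PeriodicTrialState (n + 1) L) :
    ∫ X in cellN (n + 1) L, ‖Ψ.ψ X‖ ^ 2 = 1 := by
  have hc : Continuous Ψ.ψ := Ψ.contDiff.continuous
  have hm : Continuous fun X : Config (n + 1) => ‖Ψ.ψ X‖ ^ 2 := by fun_prop
  rw [integral_eq_lintegral_of_nonneg_ae (ae_of_all _ fun X => sq_nonneg _) hm.aestronglyMeasurable]
  simp only [sdc_ofReal_norm_sq, Ψ.norm_eq, ENNReal.toReal_one]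

/-- `∫_{cell^N} |Ψ(X + e₀⊗r)|² = 1`: the shift preserves the cell integral of the periodic `|Ψ|²`.
[folklore] -/
theorem sdc_integral_norm_shift_sq (hL : 0 < L) (Ψ : PeriodicTrialState (n + 1) L) (r : Space) :
    ∫ X in cellN (n + 1) L, ‖Ψ.ψ (X + Pi.single 0 r)‖ ^ 2 = 1 := by
  have hc : Continuous Ψ.ψ := Ψ.contDiff.continuous
  have hm : Continuous fun X : Config (n + 1) => ‖Ψ.ψ (X + Pi.single 0 r)‖ ^ 2 := by fun_prop
  rw [integral_eq_lintegral_of_nonneg_ae (ae_of_all _ fun X => sq_nonneg _) hm.aestronglyMeasurable]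
  simp only [sdc_ofReal_norm_sq]
  have h2 : ∫⁻ X in cellN (n + 1) L, ((‖Ψ.ψ (X + Pi.single 0 r)‖₊ : ℝ≥0∞) ^ 2) = 1 := by
    rw [← Ψ.norm_eq]
    exact lintegral_cellN_comp_add hL (G := fun X => ((‖Ψ.ψ X‖₊ : ℝ≥0∞) ^ 2))
      (fun X i k => by simp only [Ψ.periodic]) (Pi.single 0 r)
  rw [h2, ENNReal.toReal_one]

/-- **`∫_{cell^N} |Ψ(X + e₀⊗r) − Ψ(X)|² ≤ |r|² T / N`** for a periodic trial state of `N = n + 1`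
bosons with finite kinetic energy `T`. [folklore] -/
theorem sdc_integral_norm_sub_sq_le (hL : 0 < L) (Ψ : PeriodicTrialState (n + 1) L)
    (hT : (∫⁻ X in cellN (n + 1) L, kineticDensity Ψ.ψ X) ≠ ⊤) (r : Space) :
    ∫ X in cellN (n + 1) L, ‖Ψ.ψ (X + Pi.single 0 r) - Ψ.ψ X‖ ^ 2 ≤
      ‖r‖ ^ 2 * (∫⁻ X in cellN (n + 1) L, kineticDensity Ψ.ψ X).toReal / ((n : ℝ) + 1) := by
  have hsym := sdc_lintegral_kineticDensity_eq_mul Ψ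
  have hn : ((n : ℝ≥0∞) + 1) ≠ 0 := by simp
  have hP : (∫⁻ X in cellN (n + 1) L, partialGradSq 0 Ψ.ψ X) ≠ ⊤ := by
    intro hP
    apply hT
    rw [hsym, hP, ENNReal.mul_top hn]
  have hPT : (∫⁻ X in cellN (n + 1) L, partialGradSq 0 Ψ.ψ X).toReal =
      (∫⁻ X in cellN (n + 1) L, kineticDensity Ψ.ψ X).toReal / ((n : ℝ) + 1) := by
    have h1 : ((n : ℝ≥0∞) + 1).toReal = (n : ℝ) + 1 := by
      rw [ENNReal.toReal_add (ENNReal.natCast_ne_top n) ENNReal.one_ne_top, ENNReal.toReal_natCast,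
        ENNReal.toReal_one]
    have h2 : (0 : ℝ) < (n : ℝ) + 1 := by positivity
    rw [hsym, ENNReal.toReal_mul, h1, mul_div_cancel_left₀ _ h2.ne']
  have hc : Continuous Ψ.ψ := Ψ.contDiff.continuous
  have hm : Continuous fun X : Config (n + 1) => ‖Ψ.ψ (X + Pi.single 0 r) - Ψ.ψ X‖ ^ 2 := by
    fun_prop
  rw [integral_eq_lintegral_of_nonneg_ae (ae_of_all _ fun X => sq_nonneg _) hm.aestronglyMeasurable]
  simp only [sdc_ofReal_norm_sq]
  have hle : (∫⁻ X in cellN (n + 1) L, ((‖Ψ.ψ (X + Pi.single 0 r) - Ψ.ψ X‖₊ : ℝ≥0∞) ^ 2)) ≤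
      ENNReal.ofReal (‖r‖ ^ 2) * ∫⁻ X in cellN (n + 1) L, partialGradSq 0 Ψ.ψ X :=
    sdc_lintegral_nnnorm_sub_sq_le hL Ψ r
  have hfin : ENNReal.ofReal (‖r‖ ^ 2) * (∫⁻ X in cellN (n + 1) L, partialGradSq 0 Ψ.ψ X) ≠ ⊤ :=
    ENNReal.mul_ne_top ENNReal.ofReal_ne_top hP
  have hmn := ENNReal.toReal_mono hfin hle
  rw [ENNReal.toReal_mul, ENNReal.toReal_ofReal (sq_nonneg _), hPT, ← mul_div_assoc] at hmn
  exact hmn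

/-! ### The theorem -/

/-- `(x, Y) + e₀ ⊗ r = (x + r, Y)` in `(ℝ³)^{n+1}`. [folklore] -/
theorem sdc_vecCons_add_single_zero (x r : Space) (Y : Config n) :
    (Matrix.vecCons x Y : Config (n + 1)) + Pi.single 0 r = Matrix.vecCons (x + r) Y := by
  funext j
  refine Fin.cases ?_ (fun j => ?_) j
  · simp
  · simp

/-- **Kinetic short-distance coherence** (route `BECConjugateDomination`, item
stmt-AtomisticToContinuum-11789): for every periodic `C¹` trial state `Ψ` of `N = n + 1` bosons on
the torus of side `L > 0` with finite kinetic energy `T = ∫_{cell^N} |∇Ψ|²` and every `r ∈ ℝ³`,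
`∫_cell ∫_{cell^n} |Ψ(x + r, Y)| |Ψ(x, Y)| dY dx ≥ 1 − |r|² T / (2N)`. [folklore] -/
theorem shortDistanceCoherence_proof :
    Summit.AtomisticToContinuum.BoseEinsteinCondensation.Theses.BECConjugateDomination.ShortDistanceCoherence := by
  intro n L hL Ψ hT r
  have hc : Continuous Ψ.ψ := Ψ.contDiff.continuous
  -- the four integrands on the `N`-particle cell
  have hA : Continuous fun X : Config (n + 1) => ‖Ψ.ψ (X + Pi.single 0 r)‖ * ‖Ψ.ψ X‖ := by
    fun_prop
  have hB : Continuous fun X : Config (n + 1) => ‖Ψ.ψ (X + Pi.single 0 r)‖ ^ 2 := by fun_prop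
  have hC : Continuous fun X : Config (n + 1) => ‖Ψ.ψ X‖ ^ 2 := by fun_prop
  have hD : Continuous fun X : Config (n + 1) => ‖Ψ.ψ (X + Pi.single 0 r) - Ψ.ψ X‖ ^ 2 := by
    fun_prop
  have hI : Continuous fun X : Config (n + 1) =>
      (‖Ψ.ψ (X + Pi.single 0 r)‖ ^ 2 + ‖Ψ.ψ X‖ ^ 2 - ‖Ψ.ψ (X + Pi.single 0 r) - Ψ.ψ X‖ ^ 2) / 2 := by
    fun_prop
  have iA : Integrable (fun X : Config (n + 1) => ‖Ψ.ψ (X + Pi.single 0 r)‖ * ‖Ψ.ψ X‖)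
      (volume.restrict (cellN (n + 1) L)) := integrableOn_cellN hA L
  have iB : Integrable (fun X : Config (n + 1) => ‖Ψ.ψ (X + Pi.single 0 r)‖ ^ 2)
      (volume.restrict (cellN (n + 1) L)) := integrableOn_cellN hB L
  have iC : Integrable (fun X : Config (n + 1) => ‖Ψ.ψ X‖ ^ 2)
      (volume.restrict (cellN (n + 1) L)) := integrableOn_cellN hC L
  have iD : Integrable (fun X : Config (n + 1) => ‖Ψ.ψ (X + Pi.single 0 r) - Ψ.ψ X‖ ^ 2)
      (volume.restrict (cellN (n + 1) L)) := integrableOn_cellN hD L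
  have iI : Integrable (fun X : Config (n + 1) =>
      (‖Ψ.ψ (X + Pi.single 0 r)‖ ^ 2 + ‖Ψ.ψ X‖ ^ 2 - ‖Ψ.ψ (X + Pi.single 0 r) - Ψ.ψ X‖ ^ 2) / 2)
      (volume.restrict (cellN (n + 1) L)) := integrableOn_cellN hI L
  have iBC : Integrable (fun X : Config (n + 1) => ‖Ψ.ψ (X + Pi.single 0 r)‖ ^ 2 + ‖Ψ.ψ X‖ ^ 2)
      (volume.restrict (cellN (n + 1) L)) := iB.add iC
  -- Fubini: the iterated integral of the statement is the cell integral of `A`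
  have hfub : ∫ x in cell L, ∫ Y in cellN n L,
      ‖Ψ.ψ (Matrix.vecCons (x + r) Y)‖ * ‖Ψ.ψ (Matrix.vecCons x Y)‖ =
      ∫ X in cellN (n + 1) L, ‖Ψ.ψ (X + Pi.single 0 r)‖ * ‖Ψ.ψ X‖ := by
    rw [setIntegral_cellN_succ_left_of_continuous hA]
    simp only [sdc_vecCons_add_single_zero]
  -- pointwise lower bound, integrated
  have hmono : ∫ X in cellN (n + 1) L,
      (‖Ψ.ψ (X + Pi.single 0 r)‖ ^ 2 + ‖Ψ.ψ X‖ ^ 2 - ‖Ψ.ψ (X + Pi.single 0 r) - Ψ.ψ X‖ ^ 2) / 2 ≤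
      ∫ X in cellN (n + 1) L, ‖Ψ.ψ (X + Pi.single 0 r)‖ * ‖Ψ.ψ X‖ :=
    integral_mono iI iA fun X => sdc_half_le_norm_mul_norm _ _
  have hsplit : ∫ X in cellN (n + 1) L,
      (‖Ψ.ψ (X + Pi.single 0 r)‖ ^ 2 + ‖Ψ.ψ X‖ ^ 2 - ‖Ψ.ψ (X + Pi.single 0 r) - Ψ.ψ X‖ ^ 2) / 2 =
      ((∫ X in cellN (n + 1) L, ‖Ψ.ψ (X + Pi.single 0 r)‖ ^ 2) +
        (∫ X in cellN (n + 1) L, ‖Ψ.ψ X‖ ^ 2) -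
        ∫ X in cellN (n + 1) L, ‖Ψ.ψ (X + Pi.single 0 r) - Ψ.ψ X‖ ^ 2) / 2 := by
    rw [integral_div, integral_sub iBC iD, integral_add iB iC]
  have h1 := sdc_integral_norm_shift_sq hL Ψ r
  have h2 := sdc_integral_norm_sq Ψ
  have h3 := sdc_integral_norm_sub_sq_le hL Ψ hT r
  rw [hsplit, h1, h2] at hmono
  have h4 : ‖r‖ ^ 2 * (∫⁻ X in cellN (n + 1) L, kineticDensity Ψ.ψ X).toReal / (2 * ((n : ℝ) + 1)) =
      ‖r‖ ^ 2 * (∫⁻ X in cellN (n + 1) L, kineticDensity Ψ.ψ X).toReal / ((n : ℝ) + 1) / 2 := by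
    rw [div_div, mul_comm ((n : ℝ) + 1) 2]
  calc 1 - ‖r‖ ^ 2 * (∫⁻ X in cellN (n + 1) L, kineticDensity Ψ.ψ X).toReal / (2 * ((n : ℝ) + 1))
      ≤ ∫ X in cellN (n + 1) L, ‖Ψ.ψ (X + Pi.single 0 r)‖ * ‖Ψ.ψ X‖ := by
        rw [h4]; linarith
    _ = ∫ x in cell L, ∫ Y in cellN n L,
          ‖Ψ.ψ (Matrix.vecCons (x + r) Y)‖ * ‖Ψ.ψ (Matrix.vecCons x Y)‖ := hfub.symm

end Summit.AtomisticToContinuum.BoseEinsteinCondensation.Theorems
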